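/-
Copyright: statement-level skeleton of a published paper (lit-balaban cell, Phase-2 proof seat p39 gen 10). No proof claims
beyond what the kernel checks below.
-/
import Literature.MathematicalPhysics.QuantumFieldTheory.Balaban1983to89.B3Eq316DifferenceKernelBounds
import Literature.MathematicalPhysics.QuantumFieldTheory.Balaban1983to89.B3Sect3TriangleGraphs

/-!
# B3 — T. Bałaban, *(Higgs)₂,₃ quantum fields in a finite volume. III. Renormalization*, CMP **88** (1983) 411–445
[Balaban1983Higgs3], p. 444 [PDF 34], the replacement sentence for the triangle factor of the graphs **(2.19)** and **(3.37)**,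
ON THE PRINTED INFINITE LATTICE ξℤ³: *"Now we replace the propagators G^η_{j₀}(0), G^η_{j₀} by C^ξ in the way described several
times. We get a convergent expression plus Σ_{y,y″}ξ^{2d}Γ″_μ(y,y′,y″) defined with the help of the propagator C^ξ. This expression
for the graphs (2.19) equals −q³Σ_yξ^d[(C^ξ∂^{ξ*}_μ)(y−y′)C^ξ(y−y′) − (∂^ξ_μC^ξ)(y−y′)C^ξ(y−y′)] = 0. (3.37)"*

statement-level skeleton of published theorems with citation tags; proofs where landed; nothing here is a claim about
the Yang–Mills mass gap

PDF held: `paper:balaban1983-higgs-2-3-quantum-fields-finite-volume` (journal page = PDF page + 410); p. 444 [PDF 34] read on the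
×2 render `run/shared/lean/pub/pub-balaban/b2b-balaban-ref1/pages/1983-cmp88-higgs23-III/1983-cmp88-higgs23-III-p034-x2.png` (the
two sentences above verbatim; the preceding sentences: *"Next we sum the expressions (3.36) over admissible orderings and indices
and we get the expressions of the same type but with propagators G^η_{j₀}(0), G^η_{j₀}, where j₀ is the lowest index of the external
legs. … The expression Σ_{x,x″}η^{2d}Γ′_μ(x,x′,x″) is of degree 0, so it is equal to the same expression but on the scale ξ instead
of η, ξ = L^{−j₀}."*).  Row **B3.Eq3.33-3.38** of `HOME/lit-balaban-r15/ROWS-B3.md` (fold owner r15).  CONTEXT.  (3.37) itself — the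
vanishing of the pure-`C^ξ` factor — is r15's `B3Sect3TriangleGraphs.eq337`/`eq337_Cxi` (oddness of the summand).  THIS FILE proves
the replacement sentence for the graphs (2.19) at the zero-field instance on ξℤ³, in the way gens 7–9 of this seat proved the same
sentence of p. 441 for `Π_{μμ′}`, `Π_{μμ′ν}`: the triangle factor of (2.19) is the printed pure-`C^ξ` expression with its two
propagator slots filled by the infinite-lattice propagators — the differentiated scalar line `G_{j₀}(0)` and the second line `G_{j₀}`
(both = p03's `GkLat`, rescaled: `B3Eq316ResolventZeroLattice.GxiL`, with INDEPENDENT parameters `(a₁, m₁²)`, `(a₂, m₂²)` in a window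
— the reading "vector propagator = the same lattice operator with its own mass" includes the cell's zero-field reading `G_{(j)} =
G_{(j)}(0)` as the case of equal parameters); writing `G = C^ξ + M` (`M = G(1 − m² − aP)C^ξ`, the resolvent identity of p. 437,
`B3Eq316ResolventZeroLattice.hasSum_resolvent316`) the factor splits into the pure-`C^ξ` term (3.37), which is `0`, plus the terms
with at least one `M`, which are bounded UNIFORMLY in the spacing `ξ = L^{−k}` (the "convergent expression"), although each of the two
printed terms alone is only logarithmically bounded (degree 0).
WHAT IS PROVED (`d = 3`, `ξ = L^{−k} = xiOf ℓ k`, volume element `Σ ξ³`, two-variable kernels and their differences `dK1`/`dK2` of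
`B3Eq316DifferenceKernelBounds`):
* §1 MODEL-FREE: `convK C` (the kernel `(x,y) ↦ C(x−y)`), `dK1_conv`; **`tri19`** — the triangle factor of (2.19) with kernel slots,
  `T[K₁,K₂](y′) = −q³Σ'_y ξ³[(K₁∂^{ξ*}_μ)(y,y′) − (∂^ξ_μK₁)(y,y′)]·K₂(y,y′)`; `tri19_conv` — on convolution kernels it IS r15's printed
  `lhs337`; `tri19_conv_Cxi` — hence `T[C^ξ,C^ξ] = 0` ((3.37), `eq337_Cxi`).
* §2 AT THE INSTANCE, the split `G = C^ξ + M` of the integrand (`integrand_split`: `[…G₁…]G₂ − […C…]C = [(∂M₁)(y′,·) − (M₁∂^*)(y′,·)]G₂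
  + [(∂^{ξ*}C^ξ) − (∂^ξC^ξ)]M₂`, using the symmetry of `M`), and the three uniform bounds: the two `M₁`-terms by gen 9's Fubini
  clauses of `B3Eq316DifferenceKernelBounds.exists_bounds` (the `x′`-sum performed inside the convolution defining `∂M`/`M∂^*`), the
  `M₂`-term by `|M₂| ≤ K` and the `L¹` bound of `∂C^ξ` (`B3ZdKernelConvolutions.tsum_profile_shift_le`).
* §3 **`exists_tri19_bound`** — for `L = ℓ+1 ≥ 2` and a window `[a₋,a₊] × [0,m²₊]`, `a₋ > 0`, there is `Cst` such that for every
  `k ≥ 1`, all `(a₁,m₁²), (a₂,m₂²)` in the window, all `q³ ∈ ℝ`, `μ`, `y′`: the series defining `T[G₁,G₂](y′)` converges absolutely,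
  **`|T[G₁,G₂](y′) − T[C^ξ,C^ξ](y′)| ≤ Cst·|q³|`** (the convergent expression), `T[C^ξ,C^ξ](y′) = 0` ((3.37)), hence
  **`|T[G₁,G₂](y′)| ≤ Cst·|q³|`** — the triangle vertex of (3.36) for the graphs (2.19) has a coefficient bounded uniformly in the
  spacing and the position.
HONEST SCOPE: zero external field, `d = 3`, the printed infinite lattice (no torus); both propagator slots are zero-field
scalar-type lattice propagators `(−Δ^ξ + m² + aP)^{−1}` (the vector propagator `G_{j₀}` of the print is read this way — a MODEL
INSTANCE, as in the row's other proved members); constants existential, uniform in `k ≥ 1` and the window; the graphs (2.20)/(3.38)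
and the counterterm graphs (2.21) are not treated here.  Mathlib + the cited tree files only; two model-free `def`s with bodies
(`convK`, `tri19`), theorems; no named facts; standard axioms.  Unit `lit-balaban-p39-g10` (Phase-2 proof seat p39, gen 10), HOME
`run/shared/lean/pub/lit-balaban/`, 2026-08-22.
-/

open scoped BigOperators
open Finset Filter Topology

namespace Literature.MathematicalPhysics.QuantumFieldTheory.Balaban1983to89.B3Eq337ZeroLattice

open B3Sect3VectorSelfEnergy B3CxiUniformBound B3ZdLatticeProfileSums B3ZdKernelConvolutions B3Eq316ResolventZeroLattice
  B3Eq316DifferenceKernelBounds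
open B3Sect3TriangleGraphs (lhs337 eq337_Cxi)

noncomputable section

/-! ## §1 The triangle factor of (2.19) with kernel slots (model-free) -/

section ModelFree

/-- the two-variable kernel of a translation-invariant (convolution) kernel `C`: `(x,y) ↦ C(x − y)`. [cite: Balaban1983Higgs3, (3.37) p.444] -/
def convK (C : ZSite 3 → ℝ) (x y : ZSite 3) : ℝ := C (x - y)

/-- **the triangle factor of the graphs (2.19)** with its two propagator slots as two-variable kernels on ξℤ³:
`T[K₁,K₂](y′) = −q³·Σ'_y ξ³[(K₁∂^{ξ*}_μ)(y,y′) − (∂^ξ_μK₁)(y,y′)]·K₂(y,y′)` — the printed (3.37) with `C^ξ(y−y′)` in the differentiated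
slot replaced by `K₁(y,y′)` and in the other slot by `K₂(y,y′)` (`q3` = q³ read as a real scalar, as in r15's `lhs337`).
[cite: Balaban1983Higgs3, (3.37) p.444] -/
def tri19 (ξ q3 : ℝ) (μ : Fin 3) (K₁ K₂ : ZSite 3 → ZSite 3 → ℝ) (y' : ZSite 3) : ℝ :=
  -q3 * ∑' y : ZSite 3, ξ ^ 3 * ((dK2 ξ μ K₁ y y' - dK1 ξ μ K₁ y y') * K₂ y y')

/-- kernel: `∂^ξ_μ` of a convolution kernel is the convolution kernel of `∂^ξ_μC` (companion of `dK2_conv`). [cite: Balaban1983Higgs3, (3.37) p.444] -/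
theorem dK1_conv (ξ : ℝ) (μ : Fin 3) (C : ZSite 3 → ℝ) (x y : ZSite 3) :
    dK1 ξ μ (convK C) x y = pdiffZ ξ⁻¹ μ C (x - y) := by
  unfold dK1 convK pdiffZ
  rw [show x + unitVec μ - y = x - y + unitVec μ by abel]

/-- kernel: `K∂^{ξ*}_μ` of a convolution kernel (`dK2_conv` in the `convK` spelling). [cite: Balaban1983Higgs3, (3.37) p.444] -/
theorem dK2_convK (ξ : ℝ) (μ : Fin 3) (C : ZSite 3 → ℝ) (x y : ZSite 3) :
    dK2 ξ μ (convK C) x y = pdiffAdjZ ξ⁻¹ μ C (x - y) := dK2_conv ξ μ C x y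

/-- **On convolution kernels the triangle factor IS the printed left side of (3.37)** (r15's `B3Sect3TriangleGraphs.lhs337`):
`T[C,C](y′) = −q³Σ_yξ³[(C∂^{ξ*}_μ)(y−y′)C(y−y′) − (∂^ξ_μC)(y−y′)C(y−y′)]`. [cite: Balaban1983Higgs3, (3.37) p.444] -/
theorem tri19_conv (ξ q3 : ℝ) (μ : Fin 3) (C : ZSite 3 → ℝ) (y' : ZSite 3) :
    tri19 ξ q3 μ (convK C) (convK C) y' = lhs337 ξ q3 C y' μ := by
  unfold tri19 lhs337
  congr 1
  refine tsum_congr fun y => ?_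
  rw [dK2_convK, dK1_conv, convK]
  ring

/-- **(3.37): the pure-`C^ξ` triangle factor of (2.19) vanishes** — `T[C^ξ,C^ξ](y′) = 0` for every `ξ`, `q³`, `μ`, `y′`
(r15's `eq337_Cxi`: the summand is odd in `y − y′`). [cite: Balaban1983Higgs3, (3.37) p.444] -/
theorem tri19_conv_Cxi (ξ q3 : ℝ) (μ : Fin 3) (y' : ZSite 3) :
    tri19 ξ q3 μ (convK (Cxi 3 ξ)) (convK (Cxi 3 ξ)) y' = 0 := by
  rw [tri19_conv]; exact eq337_Cxi ξ q3 y' μ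

end ModelFree

/-! ## §2 The split `G = C^ξ + M` of the integrand and the three uniform bounds at the instance -/

section Split

variable {ℓ k : ℕ} {a₁ m₁ a₂ m₂ : ℝ}

/-- kernel: `G^ξ_k(0) = C^ξ + M` as two-variable kernels (the definition of `MxiL`). [cite: Balaban1983Higgs3, (3.16) p.437] -/
theorem GxiL_eq_conv_add (ℓ k : ℕ) (a m2 : ℝ) (x z : ZSite 3) :
    GxiL ℓ k a m2 x z = convK (Cxi 3 (xiOf ℓ k)) x z + MxiL ℓ k a m2 x z := by
  unfold MxiL convK; ring

/-- **THE SPLIT OF THE INTEGRAND** (pointwise in the summation variable `y`): with `G_i = C^ξ + M_i` and the symmetry of `M₁`,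
`ξ³[(G₁∂^*)(y,y′) − (∂G₁)(y,y′)]G₂(y,y′) = ξ³[(C∂^*)(y−y′) − (∂C)(y−y′)]C(y−y′) + (ξ³(∂_μM₁)(y′,y)G₂(y,y′) − ξ³(M₁∂^*_μ)(y′,y)G₂(y,y′))
+ ξ³[(∂^{ξ*}_μC^ξ)(y−y′) − (∂^ξ_μC^ξ)(y−y′)]M₂(y,y′)` — the pure-`C^ξ` term of (3.37) plus the terms with at least one difference
kernel `M`. [cite: Balaban1983Higgs3, (3.37) p.444] -/
theorem integrand_split (μ : Fin 3) (y y' : ZSite 3) :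
    (xiOf ℓ k) ^ 3 * ((dK2 (xiOf ℓ k) μ (GxiL ℓ k a₁ m₁) y y' - dK1 (xiOf ℓ k) μ (GxiL ℓ k a₁ m₁) y y') * GxiL ℓ k a₂ m₂ y y') =
      (xiOf ℓ k) ^ 3 * ((dK2 (xiOf ℓ k) μ (convK (Cxi 3 (xiOf ℓ k))) y y' - dK1 (xiOf ℓ k) μ (convK (Cxi 3 (xiOf ℓ k))) y y') *
          convK (Cxi 3 (xiOf ℓ k)) y y') +
      (((xiOf ℓ k) ^ 3 * (dK1 (xiOf ℓ k) μ (MxiL ℓ k a₁ m₁) y' y * GxiL ℓ k a₂ m₂ y y') -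
          (xiOf ℓ k) ^ 3 * (dK2 (xiOf ℓ k) μ (MxiL ℓ k a₁ m₁) y' y * GxiL ℓ k a₂ m₂ y y')) +
        (xiOf ℓ k) ^ 3 * ((pdiffAdjZ (xiOf ℓ k)⁻¹ μ (Cxi 3 (xiOf ℓ k)) (y - y') - pdiffZ (xiOf ℓ k)⁻¹ μ (Cxi 3 (xiOf ℓ k)) (y - y')) *
          MxiL ℓ k a₂ m₂ y y')) := by
  -- symmetry of `M₁`: its column differences at `y′` are its row differences from `y′`
  have hs1 : dK2 (xiOf ℓ k) μ (MxiL ℓ k a₁ m₁) y y' = dK1 (xiOf ℓ k) μ (MxiL ℓ k a₁ m₁) y' y := by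
    unfold dK2 dK1; rw [MxiL_comm y (y' + unitVec μ), MxiL_comm y y']
  have hs2 : dK1 (xiOf ℓ k) μ (MxiL ℓ k a₁ m₁) y y' = dK2 (xiOf ℓ k) μ (MxiL ℓ k a₁ m₁) y' y := by
    unfold dK2 dK1; rw [MxiL_comm (y + unitVec μ) y', MxiL_comm y y']
  -- linearity of the differences in the kernel
  have hl2 : dK2 (xiOf ℓ k) μ (GxiL ℓ k a₁ m₁) y y' =
      dK2 (xiOf ℓ k) μ (convK (Cxi 3 (xiOf ℓ k))) y y' + dK2 (xiOf ℓ k) μ (MxiL ℓ k a₁ m₁) y y' := by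
    unfold dK2; rw [GxiL_eq_conv_add, GxiL_eq_conv_add]; ring
  have hl1 : dK1 (xiOf ℓ k) μ (GxiL ℓ k a₁ m₁) y y' =
      dK1 (xiOf ℓ k) μ (convK (Cxi 3 (xiOf ℓ k))) y y' + dK1 (xiOf ℓ k) μ (MxiL ℓ k a₁ m₁) y y' := by
    unfold dK1; rw [GxiL_eq_conv_add, GxiL_eq_conv_add]; ring
  rw [hl2, hl1, hs1, hs2, dK2_convK, dK1_conv, GxiL_eq_conv_add ℓ k a₂ m₂ y y']
  unfold convK
  ring

end Split

/-! ## §3 The replacement sentence for the graphs (2.19): the terms with `M` are convergent, (3.37) kills the rest -/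

section Main

variable {ℓ : ℕ}

/-- kernel: the `L¹` bound of a profile centred at `y′`, in the `prof` spelling: `y ↦ ξ³P_q^δ(y − y′)` is summable with sum
`≤ 833/δ³` (`q ≤ 2`; `B3ZdLatticeProfileSums.tsum_profile_le` translated). [cite: Balaban1983Higgs3, (3.16) p.437] -/
theorem summable_prof_sub {ξ δ : ℝ} (hξ : 0 < ξ) (hξ1 : ξ ≤ 1) (hδ : 0 < δ) (hδ1 : δ ≤ 1) {q : ℕ} (hq : q ≤ 2)
    (y' : ZSite 3) :
    Summable (fun y : ZSite 3 => ξ ^ 3 * prof ξ δ q (y - y')) ∧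
      ∑' y : ZSite 3, ξ ^ 3 * prof ξ δ q (y - y') ≤ 833 / δ ^ 3 := by
  obtain ⟨hs, hle⟩ := tsum_profile_le (d := 3) rfl hξ hξ1 hδ hδ1 hq
  have e := (Equiv.subRight y').tsum_eq (fun u : ZSite 3 => ξ ^ 3 * prof ξ δ q u)
  simp only [Equiv.subRight_apply] at e
  refine ⟨(Equiv.subRight y').summable_iff.2 hs, ?_⟩
  rw [e]; exact hle

/-- **p. 444 FOR THE GRAPHS (2.19), ON THE PRINTED INFINITE LATTICE ξℤ³** — *"Now we replace the propagators G^η_{j₀}(0), G^η_{j₀} by C^ξ in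
the way described several times. We get a convergent expression plus Σ_{y,y″}ξ^{2d}Γ″_μ(y,y′,y″) defined with the help of the
propagator C^ξ. This expression for the graphs (2.19) equals [(3.37)] = 0"*: for `L = ℓ + 1 ≥ 2` and a window `[a₋,a₊] × [0,m²₊]`
(`a₋ > 0`) there is `Cst > 0` such that for every `k ≥ 1` (`ξ = L^{−k}`), all `(a₁,m₁²), (a₂,m₂²)` in the window (the parameters of
the differentiated line `G₁ = G^ξ_k(0)` and of the second line `G₂`), all `q³`, `μ`, `y′`:
(i) the lattice sum defining the triangle factor `T[G₁,G₂](y′)` converges absolutely;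
(ii) `|T[G₁,G₂](y′) − T[C^ξ,C^ξ](y′)| ≤ Cst·|q³|` — the terms containing the difference kernel `M = G − C^ξ` are bounded
UNIFORMLY in the spacing and the position (*"a convergent expression"*);
(iii) `T[C^ξ,C^ξ](y′) = 0` — (3.37);
(iv) hence `|T[G₁,G₂](y′)| ≤ Cst·|q³|`: the coefficient of the local vertex (3.36) for the graphs (2.19) is bounded uniformly.
[cite: Balaban1983Higgs3, (3.37) p.444] -/
theorem exists_tri19_bound (hℓ : 1 ≤ ℓ) (amin aplus m2plus : ℝ) (ha : 0 < amin) :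
    ∃ Cst : ℝ, 0 < Cst ∧ ∀ (k : ℕ), 1 ≤ k → ∀ (a₁ m₁ a₂ m₂ : ℝ), amin ≤ a₁ → a₁ ≤ aplus → 0 ≤ m₁ → m₁ ≤ m2plus →
      amin ≤ a₂ → a₂ ≤ aplus → 0 ≤ m₂ → m₂ ≤ m2plus → ∀ (q3 : ℝ) (μ : Fin 3) (y' : ZSite 3),
      Summable (fun y : ZSite 3 => (xiOf ℓ k) ^ 3 *
          ((dK2 (xiOf ℓ k) μ (GxiL ℓ k a₁ m₁) y y' - dK1 (xiOf ℓ k) μ (GxiL ℓ k a₁ m₁) y y') * GxiL ℓ k a₂ m₂ y y')) ∧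
      |tri19 (xiOf ℓ k) q3 μ (GxiL ℓ k a₁ m₁) (GxiL ℓ k a₂ m₂) y' -
          tri19 (xiOf ℓ k) q3 μ (convK (Cxi 3 (xiOf ℓ k))) (convK (Cxi 3 (xiOf ℓ k))) y'| ≤ Cst * |q3| ∧
      tri19 (xiOf ℓ k) q3 μ (convK (Cxi 3 (xiOf ℓ k))) (convK (Cxi 3 (xiOf ℓ k))) y' = 0 ∧
      |tri19 (xiOf ℓ k) q3 μ (GxiL ℓ k a₁ m₁) (GxiL ℓ k a₂ m₂) y'| ≤ Cst * |q3| := by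
  obtain ⟨δ, C, K, hδ, hδh, hC1, hK, H⟩ := exists_bounds hℓ amin aplus m2plus ha
  have hδ1 : δ ≤ 1 := hδh.trans (by norm_num)
  have hC0 : 0 ≤ C := le_trans (by norm_num) hC1
  have hδ' : 0 < δ / 2 := by linarith
  -- the three constants: transposed Fubini (∂M₁·G₂), Fubini at rate δ/2 (M₁∂^*·G₂), and the `M₂`-term
  set A₁ : ℝ := C * C * C * ((833 / δ ^ 3) * (833 / δ ^ 3)) with hA₁
  set A₂ : ℝ := C * C * (C * (1 + 2 / δ)) * (1400 * (833 / (δ / 2 / 2) ^ 3)) with hA₂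
  set A₃ : ℝ := 2 * C * K * (833 / δ ^ 3) with hA₃
  have hA₁0 : 0 ≤ A₁ := by positivity
  have hA₂0 : 0 ≤ A₂ := by positivity
  have hA₃0 : 0 ≤ A₃ := by positivity
  refine ⟨A₁ + A₂ + A₃ + 1, by positivity, ?_⟩
  intro k hk a₁ m₁ a₂ m₂ ha1 ha1' hm1 hm1' ha2 ha2' hm2 hm2' q3 μ y'
  obtain ⟨⟨-, -, -, -, -, -, l7, l8, l9⟩, -, -, -, -, hF2, hF1⟩ := H k hk a₁ m₁ ha1 ha1' hm1 hm1'
  obtain ⟨⟨g1, -, -, -, -, -, -, -, -⟩, hM2, -, -, -, -, -⟩ := H k hk a₂ m₂ ha2 ha2' hm2 hm2'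
  set ξ := xiOf ℓ k with hξdef
  have hξ : 0 < ξ := xiOf_pos ℓ k
  have hξ1 : ξ ≤ 1 := xiOf_le_one ℓ k
  set M₁ := MxiL ℓ k a₁ m₁ with hM₁
  set M₂ := MxiL ℓ k a₂ m₂ with hM₂d
  set G₁ := GxiL ℓ k a₁ m₁ with hG₁
  set G₂ := GxiL ℓ k a₂ m₂ with hG₂
  set Cx := Cxi 3 ξ with hCx
  -- the law of the second line as the `κ` of the two Fubini clauses
  have hκ1 : ∀ y : ZSite 3, |G₂ y y'| ≤ C * prof ξ δ 1 (y - y') := fun y => g1 y y'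
  have hκ2 : ∀ y : ZSite 3, |G₂ y y'| ≤ C * (1 + 2 / δ) * prof ξ (δ / 2) 2 (y - y') := by
    intro y
    refine (g1 y y').trans ?_
    rw [mul_assoc]
    exact mul_le_mul_of_nonneg_left (profile_one_le_two_half hξ hξ1 hδ (y - y')) hC0
  -- term 1: Σ_y ξ³(∂_μM₁)(y′,y)G₂(y,y′) — transposed Fubini clause of gen 9
  obtain ⟨hs1, hb1⟩ := hF1 μ y' (fun y => G₂ y y') C hC0 hκ1
  -- term 2: Σ_y ξ³(M₁∂^*_μ)(y′,y)G₂(y,y′) — Fubini clause at rate δ/2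
  obtain ⟨hs2, hb2⟩ := hF2 (δ / 2) hδ' (by linarith) μ y' (fun y => G₂ y y') (C * (1 + 2 / δ)) (by positivity) hκ2
  -- the majorant `y ↦ ξ³P₂(y − y′)`
  obtain ⟨hsP, hbP⟩ := summable_prof_sub hξ hξ1 hδ hδ1 (le_refl 2) y'
  have hdiffC : ∀ y : ZSite 3, |pdiffAdjZ ξ⁻¹ μ Cx (y - y') - pdiffZ ξ⁻¹ μ Cx (y - y')| ≤ 2 * C * prof ξ δ 2 (y - y') := by
    intro y
    have h8 := l8 μ (y - y')
    have h9 := l9 μ (y - y')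
    refine (abs_sub _ _).trans ?_
    linarith
  -- term 3: Σ_y ξ³[(∂^*C)(y−y′) − (∂C)(y−y′)]M₂(y,y′) — `|M₂| ≤ K` and the L¹ bound of `∂C^ξ`
  have hpt3 : ∀ y : ZSite 3,
      |ξ ^ 3 * ((pdiffAdjZ ξ⁻¹ μ Cx (y - y') - pdiffZ ξ⁻¹ μ Cx (y - y')) * M₂ y y')| ≤
        2 * C * K * (ξ ^ 3 * prof ξ δ 2 (y - y')) := by
    intro y
    have hm := hM2 y y'
    rw [abs_mul, abs_of_pos (pow_pos hξ 3), abs_mul]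
    calc ξ ^ 3 * (|pdiffAdjZ ξ⁻¹ μ Cx (y - y') - pdiffZ ξ⁻¹ μ Cx (y - y')| * |M₂ y y'|)
        ≤ ξ ^ 3 * ((2 * C * prof ξ δ 2 (y - y')) * K) :=
          mul_le_mul_of_nonneg_left (mul_le_mul (hdiffC y) hm (abs_nonneg _)
            (by have := prof_nonneg hξ.le δ 2 (y - y'); positivity)) (pow_pos hξ 3).le
      _ = 2 * C * K * (ξ ^ 3 * prof ξ δ 2 (y - y')) := by ring
  have hs3 : Summable (fun y : ZSite 3 =>
      ξ ^ 3 * ((pdiffAdjZ ξ⁻¹ μ Cx (y - y') - pdiffZ ξ⁻¹ μ Cx (y - y')) * M₂ y y')) :=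
    (Summable.of_nonneg_of_le (fun y => abs_nonneg _) hpt3 (hsP.mul_left _)).of_abs
  have hb3 : |∑' y : ZSite 3, ξ ^ 3 * ((pdiffAdjZ ξ⁻¹ μ Cx (y - y') - pdiffZ ξ⁻¹ μ Cx (y - y')) * M₂ y y')| ≤ A₃ := by
    refine (abs_tsum_le_tsum_of_abs_le hs3 (hsP.mul_left _) hpt3).trans ?_
    rw [tsum_mul_left]
    exact mul_le_mul_of_nonneg_left hbP (by positivity)
  -- the pure-`C^ξ` integrand is summable (for each `ξ`: `|C^ξ| ≤ C·P₁ ≤ C·ξ^{−1}`)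
  have hpt0 : ∀ y : ZSite 3,
      |ξ ^ 3 * ((dK2 ξ μ (convK Cx) y y' - dK1 ξ μ (convK Cx) y y') * convK Cx y y')| ≤
        2 * C * (C * ξ⁻¹) * (ξ ^ 3 * prof ξ δ 2 (y - y')) := by
    intro y
    rw [dK2_convK, dK1_conv, convK]
    have h7 : |Cx (y - y')| ≤ C * ξ⁻¹ := by
      refine (l7 (y - y')).trans (mul_le_mul_of_nonneg_left ?_ hC0)
      have := profile_le_inv_pow hξ hδ.le 1 (y - y')
      simp only [pow_one] at this
      unfold prof
      simpa only [pow_one] using this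
    rw [abs_mul, abs_of_pos (pow_pos hξ 3), abs_mul]
    calc ξ ^ 3 * (|pdiffAdjZ ξ⁻¹ μ Cx (y - y') - pdiffZ ξ⁻¹ μ Cx (y - y')| * |Cx (y - y')|)
        ≤ ξ ^ 3 * ((2 * C * prof ξ δ 2 (y - y')) * (C * ξ⁻¹)) :=
          mul_le_mul_of_nonneg_left (mul_le_mul (hdiffC y) h7 (abs_nonneg _)
            (by have := prof_nonneg hξ.le δ 2 (y - y'); positivity)) (pow_pos hξ 3).le
      _ = 2 * C * (C * ξ⁻¹) * (ξ ^ 3 * prof ξ δ 2 (y - y')) := by ring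
  have hs0 : Summable (fun y : ZSite 3 =>
      ξ ^ 3 * ((dK2 ξ μ (convK Cx) y y' - dK1 ξ μ (convK Cx) y y') * convK Cx y y')) :=
    (Summable.of_nonneg_of_le (fun y => abs_nonneg _) hpt0 (hsP.mul_left _)).of_abs
  -- (i) summability of the full integrand via the split
  have hsplit : ∀ y : ZSite 3, ξ ^ 3 * ((dK2 ξ μ G₁ y y' - dK1 ξ μ G₁ y y') * G₂ y y') =
      ξ ^ 3 * ((dK2 ξ μ (convK Cx) y y' - dK1 ξ μ (convK Cx) y y') * convK Cx y y') +
        ((ξ ^ 3 * (dK1 ξ μ M₁ y' y * G₂ y y') - ξ ^ 3 * (dK2 ξ μ M₁ y' y * G₂ y y')) +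
          ξ ^ 3 * ((pdiffAdjZ ξ⁻¹ μ Cx (y - y') - pdiffZ ξ⁻¹ μ Cx (y - y')) * M₂ y y')) :=
    fun y => integrand_split μ y y'
  have hsG : Summable (fun y : ZSite 3 => ξ ^ 3 * ((dK2 ξ μ G₁ y y' - dK1 ξ μ G₁ y y') * G₂ y y')) :=
    (hs0.add ((hs1.sub hs2).add hs3)).congr (fun y => (hsplit y).symm)
  -- (ii) the difference is the sum of the three `M`-terms
  have e1 : ∑' y : ZSite 3, ξ ^ 3 * ((dK2 ξ μ G₁ y y' - dK1 ξ μ G₁ y y') * G₂ y y') =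
      ∑' y : ZSite 3, ξ ^ 3 * ((dK2 ξ μ (convK Cx) y y' - dK1 ξ μ (convK Cx) y y') * convK Cx y y') +
        ((∑' y : ZSite 3, ξ ^ 3 * (dK1 ξ μ M₁ y' y * G₂ y y') - ∑' y : ZSite 3, ξ ^ 3 * (dK2 ξ μ M₁ y' y * G₂ y y')) +
          ∑' y : ZSite 3, ξ ^ 3 * ((pdiffAdjZ ξ⁻¹ μ Cx (y - y') - pdiffZ ξ⁻¹ μ Cx (y - y')) * M₂ y y')) := by
    rw [tsum_congr hsplit, hs0.tsum_add ((hs1.sub hs2).add hs3), (hs1.sub hs2).tsum_add hs3, hs1.tsum_sub hs2]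
  have hdiff : tri19 ξ q3 μ G₁ G₂ y' - tri19 ξ q3 μ (convK Cx) (convK Cx) y' =
      -q3 * (((∑' y : ZSite 3, ξ ^ 3 * (dK1 ξ μ M₁ y' y * G₂ y y')) -
              ∑' y : ZSite 3, ξ ^ 3 * (dK2 ξ μ M₁ y' y * G₂ y y')) +
            ∑' y : ZSite 3, ξ ^ 3 * ((pdiffAdjZ ξ⁻¹ μ Cx (y - y') - pdiffZ ξ⁻¹ μ Cx (y - y')) * M₂ y y')) := by
    unfold tri19
    rw [e1]; ring
  have hii : |tri19 ξ q3 μ G₁ G₂ y' - tri19 ξ q3 μ (convK Cx) (convK Cx) y'| ≤ (A₁ + A₂ + A₃ + 1) * |q3| := by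
    rw [hdiff, abs_mul, abs_neg, mul_comm]
    refine mul_le_mul_of_nonneg_right ?_ (abs_nonneg q3)
    refine (abs_add_le _ _).trans ?_
    refine (add_le_add (abs_sub _ _) le_rfl).trans ?_
    linarith [hb1, hb2, hb3]
  have hiii : tri19 ξ q3 μ (convK Cx) (convK Cx) y' = 0 := tri19_conv_Cxi ξ q3 μ y'
  refine ⟨hsG, hii, hiii, ?_⟩
  -- (iv)
  have h4 := hii
  rwa [hiii, sub_zero] at h4

end Main


end

end Literature.MathematicalPhysics.QuantumFieldTheory.Balaban1983to89.B3Eq337ZeroLattice
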